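/-
Copyright (c) 2026. All rights reserved.
Released under Apache 2.0 license as described in the file LICENSE.
Authors: abc-iut cell, campaign-S prover seat abc-iut-S1 (wave 1).
-/
import Literature.IUT.LogVolume.LogSeriesEstimates
import HarnessLib

/-!
# `log_p(𝒪_K^×)` is a compact open subgroup of `K`; `log_p` is continuous on `𝒪_K^×`

[IUTchIV] Prop. 1.4 (p. 13) takes log-volumes `μ^log(log_p(R_i^×))` of the sets `log_p(R^×)` of
Prop. 1.2 — so they must be compact open subsets of `k_i`; [IUTchIII] Def. 1.1 (i) p. 24 / [AbsTopIII]
Def. 3.1 (iv) call `log(𝒪^×)` "a compact topological module".  For `K` in the cell's norm-side MLF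
setting (proper), this file PROVES:

* `continuousOn_unitLog` — `log_p` is continuous on the unit sphere `{‖u‖ = 1}` (indeed `1`-Lipschitz
  at small distances: `log_p u − log_p u₀ = L(u u₀⁻¹)` and `‖L(w)‖ ≤ ‖1 − w‖`, `LogSeriesEstimates`);
* `isCompact_logUnits` — `log_p(R^×)` is compact;
* `closedBall_subset_logUnits` — the ball `{‖z‖ ≤ p⁻²}` lies in `log_p(R^×)` (a uniform radius;
  the sharp one is [IUTchIV] Prop. 1.2 (i), `LogRadius.lean`), hence `isOpen_logUnits` — `log_p(R^×)` is
  OPEN (an additive subgroup containing a neighbourhood of `0`).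

Classical; nothing disputed.
-/

noncomputable section

open Filter Metric Set
open _root_.Topology
open IsUltrametricDist

namespace Literature.IUT.LogVolume

open Literature.NumberTheory.Transcendental

variable (p : ℕ) [Fact p.Prime]
variable (K : Type*) [NontriviallyNormedField K] [instK : NormedAlgebra ℚ_[p] K] [IsUltrametricDist K]
  [ProperSpace K]
include instK

omit [NontriviallyNormedField K] instK [IsUltrametricDist K] [ProperSpace K] in
/-- The uniform radius `ρ = p⁻²` satisfies `ρ · p^{1/(p−1)} < 1` (`≤ p⁻¹`).
[cite: Koblitz1984, Ch. IV §1] -/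
theorem rpow_neg_two_mul_lt_one :
    (p : ℝ) ^ (-(2 : ℝ)) * (p : ℝ) ^ (1 / ((p : ℝ) - 1)) < 1 := by
  have hp : p.Prime := Fact.out
  have hp1 : (1 : ℝ) < p := by exact_mod_cast hp.one_lt
  have hp0 : (0 : ℝ) < p := by linarith
  rw [← Real.rpow_add hp0]
  refine Real.rpow_lt_one_of_one_lt_of_neg hp1 ?_
  have h2 : (2 : ℝ) ≤ p := by exact_mod_cast hp.two_le
  have : 1 / ((p : ℝ) - 1) ≤ 1 := by rw [div_le_one (by linarith)]; linarith
  linarith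

/-- **`log_p` is `1`-Lipschitz at small distances on the unit sphere**: for a unit `u₀` and `u` with
`‖u − u₀‖ ≤ p⁻²` (so `u` is a unit too), `‖log_p u − log_p u₀‖ ≤ ‖u − u₀‖`.
[cite: NeukirchANT1999, Ch. II (5.5)] -/
theorem norm_unitLog_sub_le {u u₀ : K} (hu₀ : ‖u₀‖ = 1)
    (h : ‖u - u₀‖ ≤ (p : ℝ) ^ (-(2 : ℝ))) : ‖unitLog u - unitLog u₀‖ ≤ ‖u - u₀‖ := by
  have hp1 : (1 : ℝ) < p := by exact_mod_cast (Fact.out : p.Prime).one_lt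
  have hθ := rpow_neg_two_mul_lt_one p
  have hu₀0 : u₀ ≠ 0 := norm_pos_iff.mp (by rw [hu₀]; exact one_pos)
  set w := u * u₀⁻¹ with hw
  have hwn : ‖1 - w‖ = ‖u - u₀‖ := by
    rw [hw, show (1 : K) - u * u₀⁻¹ = (u₀ - u) * u₀⁻¹ by field_simp, norm_mul, norm_inv, hu₀,
      inv_one, mul_one, norm_sub_rev]
  have hwρ : ‖1 - w‖ ≤ (p : ℝ) ^ (-(2 : ℝ)) := hwn ▸ h
  have hρ1 : (p : ℝ) ^ (-(2 : ℝ)) < 1 := Real.rpow_lt_one_of_one_lt_of_neg hp1 (by norm_num)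
  have hwP : IsPrincipal w := hwρ.trans_lt hρ1
  have hw1 : ‖w‖ = 1 := hwP.norm_eq_one
  have huw : u = w * u₀ := by rw [hw, inv_mul_cancel_right₀ hu₀0]
  have hlog : unitLog u = unitLog w + unitLog u₀ := by rw [huw, unitLog_mul p hw1 hu₀]
  rw [hlog, add_sub_cancel_right, unitLog_of_isPrincipal p hwP, ← hwn]
  exact norm_logSeries_le_norm p K hθ.le hwρ

/-- **`log_p` is continuous on the unit sphere `R^× = {‖u‖ = 1}`.**
[cite: NeukirchANT1999, Ch. II (5.5)] -/
theorem continuousOn_unitLog : ContinuousOn (unitLog (K := K)) {u : K | ‖u‖ = 1} := by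
  have hp0 : (0 : ℝ) < (p : ℝ) ^ (-(2 : ℝ)) :=
    Real.rpow_pos_of_pos (by exact_mod_cast (Fact.out : p.Prime).pos) _
  intro u₀ hu₀
  rw [Set.mem_setOf_eq] at hu₀
  rw [ContinuousWithinAt, Metric.tendsto_nhdsWithin_nhds]
  intro ε hε
  refine ⟨min ((p : ℝ) ^ (-(2 : ℝ))) ε, lt_min hp0 hε, fun {u} _ hdist ↦ ?_⟩
  rw [dist_eq_norm] at hdist ⊢
  have h1 : ‖u - u₀‖ ≤ (p : ℝ) ^ (-(2 : ℝ)) := (hdist.trans_le (min_le_left _ _)).le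
  calc ‖unitLog u - unitLog u₀‖ ≤ ‖u - u₀‖ := norm_unitLog_sub_le p K hu₀ h1
    _ < ε := hdist.trans_le (min_le_right _ _)

omit instK [IsUltrametricDist K] in
/-- The unit sphere of a proper `K` is compact. [cite: NeukirchANT1999, Ch. II (5.5)] -/
theorem isCompact_unitSphere : IsCompact {u : K | ‖u‖ = 1} := by
  have : {u : K | ‖u‖ = 1} = Metric.sphere (0 : K) 1 := by
    ext u; simp
  rw [this]
  exact isCompact_sphere 0 1

/-- **`log_p(R^×)` is compact** ("a compact topological module", [IUTchIII] Def. 1.1 (i) p. 24).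
[claim: Mochizuki2012, status: disputed] -/
theorem isCompact_logUnits : IsCompact (logUnits K) :=
  (isCompact_unitSphere K).image_of_continuousOn (continuousOn_unitLog p K)

/-- **The ball `{‖z‖ ≤ p⁻²}` lies in `log_p(R^×)`** (every such `z` is `L(u) = log_p u` for a principal
unit `u`, `exists_logSeries_eq`; the sharp radius `p^{−a}` is [IUTchIV] Prop. 1.2 (i)).
[claim: Mochizuki2012, status: disputed] -/
theorem closedBall_subset_logUnits :
    {z : K | ‖z‖ ≤ (p : ℝ) ^ (-(2 : ℝ))} ⊆ logUnits K := by
  have hp1 : (1 : ℝ) < p := by exact_mod_cast (Fact.out : p.Prime).one_lt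
  have hρ1 : (p : ℝ) ^ (-(2 : ℝ)) < 1 := Real.rpow_lt_one_of_one_lt_of_neg hp1 (by norm_num)
  intro z hz
  rw [Set.mem_setOf_eq] at hz
  obtain ⟨u, hu, huz⟩ := exists_logSeries_eq p K (rpow_neg_two_mul_lt_one p) hz
  have huP : IsPrincipal u := hu.trans_lt hρ1
  exact ⟨u, huP.norm_eq_one, by rw [unitLog_of_isPrincipal p huP, huz]⟩

/-- `log_p(R^×)` is a neighbourhood of each of its points (it is an additive subgroup containing the
ball `{‖z‖ ≤ p⁻²}`). [claim: Mochizuki2012, status: disputed] -/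
theorem logUnits_mem_nhds {z : K} (hz : z ∈ logUnits K) : logUnits K ∈ 𝓝 z := by
  have hp0 : (0 : ℝ) < (p : ℝ) ^ (-(2 : ℝ)) :=
    Real.rpow_pos_of_pos (by exact_mod_cast (Fact.out : p.Prime).pos) _
  rw [Metric.mem_nhds_iff]
  refine ⟨(p : ℝ) ^ (-(2 : ℝ)), hp0, fun y hy ↦ ?_⟩
  rw [Metric.mem_ball, dist_eq_norm] at hy
  have hyz : y - z ∈ logUnits K := closedBall_subset_logUnits p K (by exact hy.le)
  have hsum : (y - z) + z ∈ (logUnitsAddSubgroup p K : Set K) :=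
    (logUnitsAddSubgroup p K).add_mem hyz hz
  simpa using hsum

/-- **`log_p(R^×)` is open.** [claim: Mochizuki2012, status: disputed] -/
theorem isOpen_logUnits : IsOpen (logUnits K) :=
  isOpen_iff_mem_nhds.mpr fun _ hz ↦ logUnits_mem_nhds p K hz

/-- `log_p(R^×)` is a compact open subset of `K` containing `0` — an admissible argument of the
log-volume `μ^log` of [IUTchIV] Prop. 1.4. [claim: Mochizuki2012, status: disputed] -/
theorem logUnits_compact_open : IsCompact (logUnits K) ∧ IsOpen (logUnits K) ∧ (0 : K) ∈ logUnits K :=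
  ⟨isCompact_logUnits p K, isOpen_logUnits p K, zero_mem_logUnits (p := p)⟩

end Literature.IUT.LogVolume

end
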